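import Summits.QuantumFields.BalabanUV.Beta.SpineRecursiveWEnd
import Summits.QuantumFields.BalabanUV.Beta.SecondOrderStepEval
import Summits.QuantumFields.BalabanUV.Beta.SecondOrderStepLaw
import Summits.QuantumFields.BalabanUV.Beta.StepReflection

/-!
# `BalabanUV.Beta.SpineRecursiveT2Step` — binder row D1, (L4) piece (W-E) EVALUATION, part 3c: **THE LEVEL STEP OF THE SECOND-ORDER LETTER
# LAW FOR THE RECURSIVE WALL LITERAL** — `(hT2-rem)` at level `j+1` from the W-law at level `j`, the BORDER LETTER at level `j+1` and the
# second-order LOCK, with the new second symbol and remainder DISPLAYED (`d + 1 = 4`, odd `Lc`, centred root, pin `(cE, cVH) = (Lc⁴, −Lc⁸/2)`)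
# (β sub-cell, row BETA-an2 = BINDER-OWNERS row D1 OWNER, lineage an2 gen 18)

HONEST FRAMING (cell charter, verbatim): «discharging BetaPertH makes Balaban's UV stability UNCONDITIONAL — a real
constructive-QFT result; it is NOT the continuum limit and NOT the Clay problem.»  DERIVED cell leaf (wiring, [folklore]); no statement of
Bałaban's papers, no `[cite:]`, no `def`, no `Prop` fact; instantiates no binder of the wall.  NOT D1, NOT `BetaPertH`, NOT continuum, NOT Clay.

## What is here (`G_j := coDressKBmAt ρ_c Lc (KInvStep Lc j)`, `𝕄_j := bhKStepAt 3 ρ_c Lc j`, `Sp_j := SpureRecAt … j`, `M_j := M1At … j`, `W_j := WrecAt … j`,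
## `γ_j := −(Lc⁸/2)·wVH j/(stepScale j·Lc⁴)`, `X_j κ u := diagK (γ_j·ctGen 3 α Lc κ u)`)

* `SpureRecAt_succ_eq_mmRead`: `Sp_{j+1} κ u = (Lc⁴·wE (j+1)) • mmRead Lc (K2OfK G_j Lc Sp_j M_j κ u) + (−Lc⁸/2·wVH (j+1)) • vhSAt ρ_c κ u`
  (`SpureRecAt_succ` + leaf-10's (c1) fold `dM_SpureRecAt_M1At` + `SecondOrderContactMmRead.mmRead_K2OfK_eq_e3OfK`); `T2RecAt_succ_eq_mmRead`.
* **`T2RecAt_succ_bref_of_laws`** — HYPOTHESES: (hWlaw) the W-law of `W_j` at the axis `α` with ♯-bi-table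
  `W_j b c + conjW 𝕄_j (dM G_j Lc Sp_j M_j b) (dM … c) (diagK G^γ_b) (diagK G^γ_c) (diagK (X2s b c)) + Rm b c` (the shape the (W-ASM) root
  `SpineRecursiveWEnd` derives from (hT2) at level `j`; `X2s`, `Rm` localised); (hBfm/hBmf/hBmm) THE BORDER LETTER AT LEVEL `j+1`
  (= the socket of `SecondOrderStepLaw.quarticStep_bref_of_laws` with `𝕄 := 𝕄_{j+1}`, `V := Sp_{j+1}`, `X := X_{j+1}`, symbol `hB`, remainder `RB` with zero field
  block); (hlock2) THE SECOND-ORDER LOCK `cE₂·wV4 (j+1)·wVH (j+1) = (Lc⁴·wE (j+1))²`; (hB0) the border table `vh₂S` has zero field block.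
  CONCLUSION: `T2RecAt … (j+1) κ (bref u) κ′ (bref u′) = (ε ε) • refK (T2RecAt … (j+1) κ u κ′ u′ + conjW 𝕄_{j+1} (Sp_{j+1} κ u) (Sp_{j+1} κ′ u′) (X_{j+1} κ u) (X_{j+1} κ′ u′) (diagK (hB …)) + R2′ …)`
  with the DISPLAYED new remainder `R2′ κ u κ′ u′ := −(cE₂·wV4 (j+1)) • mmRead Lc (G_j ∘ Rm κuκ′u′ ∘ G_j) + RB κuκ′u′ + conjV (mmRead Lc G_j) (diagK ((cE₂·wV4 (j+1))·mmSym Lc (X2s κuκ′u′) − wVH (j+1)·hB κuκ′u′))`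
  — i.e. **(hT2-rem) AT LEVEL `j+1` with second symbol `hB` and remainder `R2′`**.  Inside: `SpureRecAt_bref`, `M1At_bref`, the first-order locks at the pin
  (`locks_of_pin`/`pin_of_bcj`), `SecondOrderStepEval.mmRead_K3OfK_stepProp_bref` (transport + evaluation, every propagator-side condition discharged),
  `SecondOrderStepLaw.quarticStep_bref_of_laws` (assembly), `bhKStepAt_succ_inl_inl` + `mmRead_coDressKBmAt_KInvStep` (the field block of `𝕄_{j+1}` is
  `wVH (j+1) · mmRead Lc G_j`), `smul_vhSAt_inl_inl`.
NOT HERE: the W-law ⟸ (hT2-rem) at level `j` (the body of `SpineRecursiveWEnd`, to be exposed standalone), the border letter itself (an1), the row-parity ∕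
localisation of `R2′` (swarm leaf), the induction over `j` and the level-`0` letters (an3/an1).  Provenance: β sub-cell, unit beta-an2 gen 18, 2026-08-20 (v1);
no existing file touched.
-/

open Finset
open scoped BigOperators
open Literature.MathematicalPhysics.QuantumFieldTheory
open Literature.MathematicalPhysics.QuantumFieldTheory.Balaban1983to89
open Literature.MathematicalPhysics.QuantumFieldTheory.Balaban1983to89.Beta
open ExpKernelCalculus (MKer Decays BiLoc comp VertexFamily VertexFamily₂)
open AffineAveraging (box toSite)
open AveragingContoursRooted (ctr ctrOff ctrOff_mem_box)
open AveragingHessianKernelsRooted (vhSAt)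
open PolarizationSign (reflSign)
open KernelReflection (refK)
open ResolventReflection (bref Φ)
open OneStepResolventKernel (Fib LocStencil)
open OneStepKernelFamily (KInvStep colH vertexOfK vertexFamily_vertexOfK')
open BalabanStepJetsSucc (mmRead wE wVH)
open BalabanStepW2 (M2Of K3OfK wV4 wB2)
open BalabanCompositeJets (LocStencil₂)
open SecondOrderResponse (dM K2OfK W2SymOfK LocStencilFM)
open Summit.QuantumFields.BalabanUV.Beta.TameKernelCalculus
open Summit.QuantumFields.BalabanUV.Beta.ChartConjugation (conjV conjW)
open Summit.QuantumFields.BalabanUV.Beta.AxialDressingRooted (coDressKBmAt decays_coDressKBmAt_KInvStep)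
open Summit.QuantumFields.BalabanUV.Beta.BorderedHessian (diagK ctGen bhKStepAt bhKStepAt_succ_inl_inl stepScale stepScale_ne_zero)
open Summit.QuantumFields.BalabanUV.Beta.WardLocusRecursive (SrecAt locStencil_SrecAt)
open Summit.QuantumFields.BalabanUV.Beta.WardLocusInduction (mmRead_coDressKBmAt_KInvStep)
open Summit.QuantumFields.BalabanUV.Beta.WardLocusCubic (mmSym)
open Summit.QuantumFields.BalabanUV.Beta.SecondOrderContactMmRead (mmRead_K2OfK_eq_e3OfK)
open Summit.QuantumFields.BalabanUV.Beta.SecondOrderStepEval (mmRead_K3OfK_stepProp_bref)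
open Summit.QuantumFields.BalabanUV.Beta.SecondOrderStepLaw (quarticStep_bref_of_laws)
open Summit.QuantumFields.BalabanUV.Beta.E3GenericReflection (Spr.decays')

noncomputable section

namespace Summit.QuantumFields.BalabanUV.Beta.SpineRooted

section Wall

variable {Lc : ℕ} [NeZero Lc]

/-- [folklore] **THE NEXT PURE TABLE IN `mmRead ∘ K2OfK` FORM** (any root in the block, any coefficients):
`SpureRecAt (j+1) κ u = (cE·wE (j+1)) • mmRead Lc (K2OfK G_j Lc (SpureRecAt j) (M1At j) κ u) + (cVH·wVH (j+1)) • vhSAt ρ κ u`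
(`SpureRecAt_succ`; `e3OfK Lc G_j (SrecAt j) = mmRead Lc (K2OfK …)` by `mmRead_K2OfK_eq_e3OfK` + the (c1) fold `dM_SpureRecAt_M1At`). -/
theorem SpureRecAt_succ_eq_mmRead {d : ℕ} {r : Fin (d + 1) → ℕ} (hr : r ∈ box (d + 1) Lc) (cE cVH cΛ : ℝ) (j : ℕ) (κ : Fin (d + 1))
    (u : Fin (d + 1) → ℤ) :
    SpureRecAt d Lc (toSite r) cE cVH cΛ (j + 1) κ u =
      (cE * wE d Lc (j + 1)) • mmRead Lc (K2OfK (coDressKBmAt (toSite r) Lc (KInvStep (d := d) Lc j)) Lc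
          (SpureRecAt d Lc (toSite r) cE cVH cΛ j) (M1At d Lc (toSite r) cΛ j) κ u) +
        (cVH * wVH d Lc (j + 1)) • vhSAt (toSite r) d Lc rfl κ u := by
  rw [SpureRecAt_succ, mmRead_K2OfK_eq_e3OfK _ κ u (dM_SpureRecAt_M1At hr cE cVH cΛ j κ u)]

/-- [folklore] **THE NEXT SECOND-ORDER TABLE IN `mmRead ∘ K3OfK` FORM**: `T2RecAt (j+1) κ u κ′ u′ = (cE₂·wV4 (j+1)) • mmRead Lc (K3OfK G_j Lc (SpureRecAt j) (M1At j) (WrecAt j) κ u κ′ u′)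
+ (cB·wB2 (j+1)) • vh₂S κ u κ′ u′` (`T2RecAt_succ`, `e4OfKW` unfolded). -/
theorem T2RecAt_succ_eq_mmRead {d : ℕ} (ρ : Fin (d + 1) → ℤ) (cE cVH cΛ cE₂ cB : ℝ) (T : Fin 4 → Fin 4 → Fin 4 → Fin 4 → ℝ)
    (vh₂S mixFF : Fin (d + 1) → (Fin (d + 1) → ℤ) → Fin (d + 1) → (Fin (d + 1) → ℤ) → MKer (d + 1) (Fib d)) (j : ℕ) (κ : Fin (d + 1))
    (u : Fin (d + 1) → ℤ) (κ' : Fin (d + 1)) (u' : Fin (d + 1) → ℤ) :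
    T2RecAt d Lc ρ cE cVH cΛ cE₂ cB T vh₂S mixFF (j + 1) κ u κ' u' =
      (cE₂ * wV4 d Lc (j + 1)) • mmRead Lc (K3OfK (coDressKBmAt ρ Lc (KInvStep (d := d) Lc j)) Lc (SpureRecAt d Lc ρ cE cVH cΛ j)
          (M1At d Lc ρ cΛ j) (WrecAt d Lc ρ cE cVH cΛ cE₂ cB T vh₂S mixFF j) κ u κ' u') +
        (cB * wB2 d Lc (j + 1)) • vh₂S κ u κ' u' := by
  rw [T2RecAt_succ]; rfl

/-- [folklore] **THE LEVEL STEP OF THE SECOND-ORDER LETTER LAW FOR THE RECURSIVE WALL LITERAL** (see the module docstring): (hT2-rem) at level `j+1`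
with second symbol `hB` and the displayed remainder, from the W-law at level `j`, the border letter at level `j+1` and the second-order lock. -/
theorem T2RecAt_succ_bref_of_laws (hLc : Odd Lc) (cΛ cE₂ cB : ℝ) (T : Fin 4 → Fin 4 → Fin 4 → Fin 4 → ℝ)
    {vh₂S : Fin 4 → (Fin 4 → ℤ) → Fin 4 → (Fin 4 → ℤ) → MKer 4 (Fib 3)} (hB2 : ∃ C δ : ℝ, 0 < δ ∧ LocStencil₂ vh₂S C δ)
    (hB0 : ∀ κ u κ' u' (x z : Fin 4 → ℤ) (β β' : Fin 4), vh₂S κ u κ' u' x z (Sum.inl β) (Sum.inl β') = 0)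
    {mixFF : Fin 4 → (Fin 4 → ℤ) → Fin 4 → (Fin 4 → ℤ) → MKer 4 (Fib 3)} (hmix : ∃ C δ : ℝ, 0 < δ ∧ LocStencilFM Lc mixFF C δ)
    (γ : ℕ → ℝ) (hγ : ∀ j, γ j = -((Lc : ℝ) ^ 8 / 2) * wVH 3 Lc j / (stepScale 3 Lc j * (Lc : ℝ) ^ 4))
    (hlock2 : ∀ j, cE₂ * wV4 3 Lc (j + 1) * wVH 3 Lc (j + 1) = ((Lc : ℝ) ^ 4 * wE 3 Lc (j + 1)) ^ 2)
    (j : ℕ) (α : Fin 4)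
    (X2s : Fin 4 → (Fin 4 → ℤ) → Fin 4 → (Fin 4 → ℤ) → (Fin 4 → ℤ) → Fib 3 → ℝ) (Rm : Fin 4 → (Fin 4 → ℤ) → Fin 4 → (Fin 4 → ℤ) → MKer 4 (Fib 3))
    (hX2L : ∀ μ y ν y', Loc (diagK (X2s μ y ν y'))) (hRmL : ∀ μ y ν y', Loc (Rm μ y ν y'))
    (hWlaw : ∀ μ y ν y',
      WrecAt 3 Lc (toSite (ctrOff 4 Lc)) ((Lc : ℝ) ^ 4) (-((Lc : ℝ) ^ 8 / 2)) cΛ cE₂ cB T vh₂S mixFF j μ (bref α μ y) ν (bref α ν y') =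
        (reflSign α μ * reflSign α ν) • refK (Φ Lc α)
          (WrecAt 3 Lc (toSite (ctrOff 4 Lc)) ((Lc : ℝ) ^ 4) (-((Lc : ℝ) ^ 8 / 2)) cΛ cE₂ cB T vh₂S mixFF j μ y ν y' +
            conjW (bhKStepAt 3 (toSite (ctrOff 4 Lc)) Lc j)
              (dM (coDressKBmAt (toSite (ctrOff 4 Lc)) Lc (KInvStep (d := 3) Lc j)) Lc
                (SpureRecAt 3 Lc (toSite (ctrOff 4 Lc)) ((Lc : ℝ) ^ 4) (-((Lc : ℝ) ^ 8 / 2)) cΛ j) (M1At 3 Lc (toSite (ctrOff 4 Lc)) cΛ j) μ y)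
              (dM (coDressKBmAt (toSite (ctrOff 4 Lc)) Lc (KInvStep (d := 3) Lc j)) Lc
                (SpureRecAt 3 Lc (toSite (ctrOff 4 Lc)) ((Lc : ℝ) ^ 4) (-((Lc : ℝ) ^ 8 / 2)) cΛ j) (M1At 3 Lc (toSite (ctrOff 4 Lc)) cΛ j) ν y')
              (diagK fun p c => ∑ κ, ∑' u, colH (coDressKBmAt (toSite (ctrOff 4 Lc)) Lc (KInvStep (d := 3) Lc j)) Lc μ y κ u * (γ j * ctGen 3 α Lc κ u p c))
              (diagK fun p c => ∑ κ, ∑' u, colH (coDressKBmAt (toSite (ctrOff 4 Lc)) Lc (KInvStep (d := 3) Lc j)) Lc ν y' κ u * (γ j * ctGen 3 α Lc κ u p c))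
              (diagK (X2s μ y ν y')) + Rm μ y ν y'))
    (hB : Fin 4 → (Fin 4 → ℤ) → Fin 4 → (Fin 4 → ℤ) → (Fin 4 → ℤ) → Fib 3 → ℝ) (RB : Fin 4 → (Fin 4 → ℤ) → Fin 4 → (Fin 4 → ℤ) → MKer 4 (Fib 3))
    (hRBff : ∀ κ u κ' u' (x z : Fin 4 → ℤ) (β β' : Fin 4), RB κ u κ' u' x z (Sum.inl β) (Sum.inl β') = 0)
    (hBfm : ∀ κ u κ' u' (x z : Fin 4 → ℤ) (β m : Fin 4),
      ((cB * wB2 3 Lc (j + 1)) • vh₂S κ (bref α κ u) κ' (bref α κ' u')) x z (Sum.inl β) (Sum.inr m) =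
        ((reflSign α κ * reflSign α κ') • refK (Φ Lc α) ((cB * wB2 3 Lc (j + 1)) • vh₂S κ u κ' u' +
          conjW (bhKStepAt 3 (toSite (ctrOff 4 Lc)) Lc (j + 1))
            (SpureRecAt 3 Lc (toSite (ctrOff 4 Lc)) ((Lc : ℝ) ^ 4) (-((Lc : ℝ) ^ 8 / 2)) cΛ (j + 1) κ u)
            (SpureRecAt 3 Lc (toSite (ctrOff 4 Lc)) ((Lc : ℝ) ^ 4) (-((Lc : ℝ) ^ 8 / 2)) cΛ (j + 1) κ' u')
            (diagK fun p c => γ (j + 1) * ctGen 3 α Lc κ u p c) (diagK fun p c => γ (j + 1) * ctGen 3 α Lc κ' u' p c) (diagK (hB κ u κ' u')) +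
          RB κ u κ' u')) x z (Sum.inl β) (Sum.inr m))
    (hBmf : ∀ κ u κ' u' (x z : Fin 4 → ℤ) (m β : Fin 4),
      ((cB * wB2 3 Lc (j + 1)) • vh₂S κ (bref α κ u) κ' (bref α κ' u')) x z (Sum.inr m) (Sum.inl β) =
        ((reflSign α κ * reflSign α κ') • refK (Φ Lc α) ((cB * wB2 3 Lc (j + 1)) • vh₂S κ u κ' u' +
          conjW (bhKStepAt 3 (toSite (ctrOff 4 Lc)) Lc (j + 1))
            (SpureRecAt 3 Lc (toSite (ctrOff 4 Lc)) ((Lc : ℝ) ^ 4) (-((Lc : ℝ) ^ 8 / 2)) cΛ (j + 1) κ u)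
            (SpureRecAt 3 Lc (toSite (ctrOff 4 Lc)) ((Lc : ℝ) ^ 4) (-((Lc : ℝ) ^ 8 / 2)) cΛ (j + 1) κ' u')
            (diagK fun p c => γ (j + 1) * ctGen 3 α Lc κ u p c) (diagK fun p c => γ (j + 1) * ctGen 3 α Lc κ' u' p c) (diagK (hB κ u κ' u')) +
          RB κ u κ' u')) x z (Sum.inr m) (Sum.inl β))
    (hBmm : ∀ κ u κ' u' (x z : Fin 4 → ℤ) (m m' : Fin 4),
      ((cB * wB2 3 Lc (j + 1)) • vh₂S κ (bref α κ u) κ' (bref α κ' u')) x z (Sum.inr m) (Sum.inr m') =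
        ((reflSign α κ * reflSign α κ') • refK (Φ Lc α) ((cB * wB2 3 Lc (j + 1)) • vh₂S κ u κ' u' +
          conjW (bhKStepAt 3 (toSite (ctrOff 4 Lc)) Lc (j + 1))
            (SpureRecAt 3 Lc (toSite (ctrOff 4 Lc)) ((Lc : ℝ) ^ 4) (-((Lc : ℝ) ^ 8 / 2)) cΛ (j + 1) κ u)
            (SpureRecAt 3 Lc (toSite (ctrOff 4 Lc)) ((Lc : ℝ) ^ 4) (-((Lc : ℝ) ^ 8 / 2)) cΛ (j + 1) κ' u')
            (diagK fun p c => γ (j + 1) * ctGen 3 α Lc κ u p c) (diagK fun p c => γ (j + 1) * ctGen 3 α Lc κ' u' p c) (diagK (hB κ u κ' u')) +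
          RB κ u κ' u')) x z (Sum.inr m) (Sum.inr m'))
    (κ : Fin 4) (u : Fin 4 → ℤ) (κ' : Fin 4) (u' : Fin 4 → ℤ) :
    T2RecAt 3 Lc (toSite (ctrOff 4 Lc)) ((Lc : ℝ) ^ 4) (-((Lc : ℝ) ^ 8 / 2)) cΛ cE₂ cB T vh₂S mixFF (j + 1) κ (bref α κ u) κ' (bref α κ' u') =
      (reflSign α κ * reflSign α κ') • refK (Φ Lc α)
        (T2RecAt 3 Lc (toSite (ctrOff 4 Lc)) ((Lc : ℝ) ^ 4) (-((Lc : ℝ) ^ 8 / 2)) cΛ cE₂ cB T vh₂S mixFF (j + 1) κ u κ' u' +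
          conjW (bhKStepAt 3 (toSite (ctrOff 4 Lc)) Lc (j + 1))
            (SpureRecAt 3 Lc (toSite (ctrOff 4 Lc)) ((Lc : ℝ) ^ 4) (-((Lc : ℝ) ^ 8 / 2)) cΛ (j + 1) κ u)
            (SpureRecAt 3 Lc (toSite (ctrOff 4 Lc)) ((Lc : ℝ) ^ 4) (-((Lc : ℝ) ^ 8 / 2)) cΛ (j + 1) κ' u')
            (diagK fun p c => γ (j + 1) * ctGen 3 α Lc κ u p c) (diagK fun p c => γ (j + 1) * ctGen 3 α Lc κ' u' p c) (diagK (hB κ u κ' u')) +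
          (-((cE₂ * wV4 3 Lc (j + 1)) • mmRead Lc
              (comp (comp (coDressKBmAt (toSite (ctrOff 4 Lc)) Lc (KInvStep (d := 3) Lc j)) (Rm κ u κ' u'))
                (coDressKBmAt (toSite (ctrOff 4 Lc)) Lc (KInvStep (d := 3) Lc j)))) +
            RB κ u κ' u' +
            conjV (mmRead Lc (coDressKBmAt (toSite (ctrOff 4 Lc)) Lc (KInvStep (d := 3) Lc j)))
              (diagK fun p c => cE₂ * wV4 3 Lc (j + 1) * mmSym Lc (X2s κ u κ' u') p c - wVH 3 Lc (j + 1) * hB κ u κ' u' p c))) := by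
  have hL1 : 1 ≤ Lc := hLc.pos
  have hr := ctrOff_mem_box (d := 4) hL1
  set G := coDressKBmAt (toSite (ctrOff 4 Lc)) Lc (KInvStep (d := 3) Lc j) with hG
  have hKd : ∃ δ C : ℝ, 0 < δ ∧ 0 ≤ C ∧ Decays G C δ := decays_coDressKBmAt_KInvStep (d := 3) hr j
  -- the first-order locks at the pin and the first-order laws at level j
  have hn : 2 * (-((Lc : ℝ) ^ 8 / 2)) = -((Lc : ℝ) ^ 4 * (Lc : ℝ) ^ 4) := by ring
  have hlock : ∀ j, (Lc : ℝ) ^ 4 * wE 3 Lc (j + 1) * (γ j / (stepScale 3 Lc j * (Lc : ℝ) ^ 4 * wVH 3 Lc (j + 1))) = γ (j + 1) := by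
    intro j; rw [hγ, hγ]; exact locks_of_pin (Lc := Lc) ((Lc : ℝ) ^ 4) (-((Lc : ℝ) ^ 8 / 2)) (pin_of_bcj (Lc := Lc) _ rfl) j
  have hSp := SpureRecAt_bref hLc ((Lc : ℝ) ^ 4) (-((Lc : ℝ) ^ 8 / 2)) cΛ hn γ hγ hlock j α
  -- localisations of the level-j letters
  have hD : ∀ (ν : Fin 4) (y' : Fin 4 → ℤ), Loc (dM G Lc (SpureRecAt 3 Lc (toSite (ctrOff 4 Lc)) ((Lc : ℝ) ^ 4) (-((Lc : ℝ) ^ 8 / 2)) cΛ j)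
      (M1At 3 Lc (toSite (ctrOff 4 Lc)) cΛ j) ν y') := by
    intro ν y'
    rw [hG, dM_SpureRecAt_M1At hr _ _ cΛ j ν y']
    obtain ⟨Cs, δs, hδs, hS⟩ := locStencil_SrecAt (d := 3) hL1 hr ((Lc : ℝ) ^ 4) (-((Lc : ℝ) ^ 8 / 2)) cΛ j
    obtain ⟨Cv, δv, hδv, hV⟩ := vertexFamily_vertexOfK' (N := Lc) hKd hS hδs
    exact ⟨_, _, Cv, δv, hδv, hV ν y'⟩
  have hWl : ∀ (μ : Fin 4) (y : Fin 4 → ℤ) (ν : Fin 4) (y' : Fin 4 → ℤ),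
      Loc (WrecAt 3 Lc (toSite (ctrOff 4 Lc)) ((Lc : ℝ) ^ 4) (-((Lc : ℝ) ^ 8 / 2)) cΛ cE₂ cB T vh₂S mixFF j μ y ν y') := by
    intro μ y ν y'
    obtain ⟨Cw, δw, hδw, hW⟩ := vertexFamily₂_WrecAt' ((Lc : ℝ) ^ 4) (-((Lc : ℝ) ^ 8 / 2)) cΛ cE₂ cB T vh₂S mixFF hL1 hr hB2 hmix j
    exact ⟨_, _, Cw, δw, hδw, hW μ y ν y'⟩
  -- the evaluated law of the field sector (transport + inverse shape + mm-read, every propagator-side condition discharged)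
  have hQ := mmRead_K3OfK_stepProp_bref hLc j (γ j) hSp (M1At_bref (d := 3) hLc cΛ j α) hWlaw
    (locStencil_SpureRecAt hL1 hr _ _ cΛ j) hD hWl hRmL hX2L
  -- the coefficients
  have hw : wVH 3 Lc (j + 1) ≠ 0 := wVH_ne_zero (j + 1)
  have hγ' : γ (j + 1) = (Lc : ℝ) ^ 4 * wE 3 Lc (j + 1) * (γ j / (stepScale 3 Lc j * (Lc : ℝ) ^ 4)) / wVH 3 Lc (j + 1) := by
    rw [← hlock j]
    field_simp
  have ha : cE₂ * wV4 3 Lc (j + 1) = ((Lc : ℝ) ^ 4 * wE 3 Lc (j + 1)) ^ 2 / wVH 3 Lc (j + 1) := by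
    rw [eq_div_iff hw]; exact hlock2 j
  have hff : ∀ (x z : Fin 4 → ℤ) (β β' : Fin 4), bhKStepAt 3 (toSite (ctrOff 4 Lc)) Lc (j + 1) x z (Sum.inl β) (Sum.inl β') =
      wVH 3 Lc (j + 1) * mmRead Lc G x z (Sum.inl β) (Sum.inl β') := fun x z β β' => by
    rw [bhKStepAt_succ_inl_inl, hG, mmRead_coDressKBmAt_KInvStep]
  have hVff : ∀ κ u (x z : Fin 4 → ℤ) (β β' : Fin 4),
      ((-((Lc : ℝ) ^ 8 / 2) * wVH 3 Lc (j + 1)) • vhSAt (toSite (ctrOff 4 Lc)) 3 Lc rfl κ u) x z (Sum.inl β) (Sum.inl β') = 0 :=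
    fun κ u x z β β' => smul_vhSAt_inl_inl (Lc := Lc) _ _ κ u x z β β'
  -- the next-level tables in `mmRead` form
  have eSp : ∀ (κ : Fin 4) (u : Fin 4 → ℤ), SpureRecAt 3 Lc (toSite (ctrOff 4 Lc)) ((Lc : ℝ) ^ 4) (-((Lc : ℝ) ^ 8 / 2)) cΛ (j + 1) κ u =
      ((Lc : ℝ) ^ 4 * wE 3 Lc (j + 1)) • mmRead Lc (K2OfK G Lc (SpureRecAt 3 Lc (toSite (ctrOff 4 Lc)) ((Lc : ℝ) ^ 4) (-((Lc : ℝ) ^ 8 / 2)) cΛ j)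
          (M1At 3 Lc (toSite (ctrOff 4 Lc)) cΛ j) κ u) +
        (-((Lc : ℝ) ^ 8 / 2) * wVH 3 Lc (j + 1)) • vhSAt (toSite (ctrOff 4 Lc)) 3 Lc rfl κ u :=
    fun κ u => SpureRecAt_succ_eq_mmRead hr _ _ cΛ j κ u
  simp only [eSp] at hBfm hBmf hBmm ⊢
  rw [T2RecAt_succ_eq_mmRead, T2RecAt_succ_eq_mmRead]
  exact quarticStep_bref_of_laws (hh := fun κ u κ' u' => mmSym Lc (X2s κ u κ' u')) hw hγ' ha hff hB0 hRBff hVff hQ hBfm hBmf hBmm κ u κ' u'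

end Wall

end Summit.QuantumFields.BalabanUV.Beta.SpineRooted

end
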